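import Summits.QuantumFields.YangMills.Theorems.AlphaInputsT3ACv3BoxStokes
import Summits.QuantumFields.YangMills.Theorems.AlphaInputsT3ACv3FourBlockGeom
import HarnessLib

/-!
# `AlphaInputsT3ACv3Prop1Blocks` — [Balaban1985Averaging] PROPOSITION 1 (51) FOR THE (0.4) AVERAGING OF RECORD, SHARP (SECOND ORDER) **WITH THE
# PRINTED LOCALITY `Δ(p′)`**: the hypothesis is on the fine plaquettes of the FOUR BLOCKS under the corners of `p′` only — lane
# `pub-balaban3d`, seat alpha-2 (g4)

WHY (HOME `pub-balaban3d` STATUS, alpha-2 g4).  Print, p. 25: «Let us notice that it is a local result; the bound above depends on bounds for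
V(∂p) − 1 on Δ(p′), i.e., for p ⊂ Δ(p′).»  The tree has the sharp Prop. 1 for `blockAvg expMeanLogSU` under GLOBAL smallness
(`BlockAveragingEMLProp2.dist1_plaqHol_avgFun_le`) and under WALK-LOCAL smallness of radius `(d+4)L + 2` around the block centre
(`N21LocalAveragedRegularity.dist1_plaqHol_avgFun_le_sharp_loc` — «the walk hull of the tree's CRUDE Stokes letters … not the printed four blocks
Δ(p′)», its own honest framing).  For the GLUED witnesses of the lane's non-emptiness row (D6R-CHARGED) only EXACT locality is usable: a
plaquette of `Ω_k(h)` must be controlled by the configuration UNDER `Ω_k(h)` alone.  THIS FILE closes the gap: ★★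
`dist1_plaqHol_avgFun_le_fourBlock` — if every level-`j` plaquette whose lower-left and upper-right corners lie in blocks among the four corners
`y, y+e_μ, y+e_ν, y+e_μ+e_ν` of `p′` is within `a ≥ 0` of `1` and `(((d+4)L)²/4)·a ≤ δ_N/2`, then
`|Ū(∂p′) − 1| ≤ L²a + 143·((((d+4)L)²/4)·a)² = L²a + C₀(d)(L²a)²` (`Ū = avgFun expMeanLogSU U`, standing range `j + 1 ≤ m + K`).
HOW.  The atomised sharp bound `BlockAveragingEMLProp2.dist1_plaqHol_avgFun_le_of_atoms` consumes only: (W) the loop variables at the four bonds of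
`∂p′` — each lives in two of the four blocks (`BoxStokes.dist1_loopHol_le_twoBlock`); (Z) the transport loops, closed words whose prefixes stay in the
four-block box (`BoxStokes.netDisp_take_zWord`, `blockOf_mem_four_of_near`), bounded by the box-local Stokes bound `BoxStokes.dist1_holAt_le_pi'`
over the product set `blockOf_mem_four_iff`; (Q) the straight and translated `L × L` squares (`BoxStokes.dist1_rect_le_fourBlock`).  §2 gives the
`PlaqSmallOn` ∕ regional corollaries (`plaqSmallOn_avgFun_sharp_of_blocks`): smallness of the fine plaquettes whose extreme corners lie in blocks
of a set `R` of coarse sites gives the sharp bound at every coarse plaquette with all four corners in `R` — the one-step form of the regional Prop. 2.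
HONEST FRAMING.  Nothing of [Balaban1985Averaging] is asserted; kernel theorems over the tree's own (0.4) objects; count-neutral helper toward R3 2′
(`stub_laneRecordsV3`, items 19935∕19936); registry untouched; nothing about d = 4, the continuum, or a mass gap.

References: T. Bałaban, Commun. Math. Phys. 98 (1985) 17–51 [Balaban1985Averaging] (Prop. 1 (51) pp.25–26, (19)–(20) p.21); CMP 109 (1987)
249–301 [Balaban1987RG1] ((0.3)–(0.4) pp.252–253).
-/

set_option autoImplicit false

namespace Summit.QuantumFields.YangMills.Theorems.BoxStokes

open Literature.MathematicalPhysics.QuantumFieldTheory.Balaban1983to89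
open T4Continuum T4ReflectionCone BlockAveraging AveragingRT B10Eq47AxialChi ExpMeanLog BlockAveragingEMLProp2

variable {P : Params} {j : ℕ} {n : Type*} [Fintype n] [DecidableEq n] [Nonempty n]

/-! ## §1 Prop. 1 (51), sharp, from the four blocks under the corners of `p′` -/

section FourBlock

/-- **★★ [Balaban1985Averaging] PROP. 1 (51) FOR (0.4), SHARP AND WITH THE PRINTED LOCALITY `Δ(p′)`** (`SU(N)`, `ℰ = expMeanLogSU`, standing range
`j + 1 ≤ m + K`): if every fine plaquette whose lower-left corner and upper-right corner lie in blocks among the four corners of the coarse plaquette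
`p′ = ⟨y, μ, ν⟩` is within `a ≥ 0` of `1`, and `(((d+4)L)²/4)·a ≤ δ_N/2`, then `|Ū(∂p′) − 1| ≤ L²a + 143·((((d+4)L)²/4)·a)²`.
[cite: Balaban1985Averaging, Prop. 1 (51) pp.25–26] -/
theorem dist1_plaqHol_avgFun_le_fourBlock (hj : j + 1 ≤ P.m + P.K) {a : ℝ} (ha : 0 ≤ a)
    {U : GaugeField P j (Matrix.specialUnitaryGroup n ℂ)} (hs : ((((P.d + 4) * P.L : ℕ) : ℝ) ^ 2 / 4) * a ≤ deltaSU n / 2)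
    (y : Site P (j + 1)) {μ ν : Fin P.d} (hμν : μ < ν)
    (hU : ∀ q : Plaq P j,
      (blockOf q.src = y ∨ blockOf q.src = y.shift μ ∨ blockOf q.src = y.shift ν ∨ blockOf q.src = (y.shift μ).shift ν) →
      (blockOf ((q.src.shift q.μ).shift q.ν) = y ∨ blockOf ((q.src.shift q.μ).shift q.ν) = y.shift μ ∨
        blockOf ((q.src.shift q.μ).shift q.ν) = y.shift ν ∨ blockOf ((q.src.shift q.μ).shift q.ν) = (y.shift μ).shift ν) →
      dist1 (GaugeField.plaqHol U q) ≤ a) :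
    dist1 (GaugeField.plaqHol (avgFun (expMeanLogSU (n := n)) U) ⟨y, μ, ν, hμν⟩) ≤
      (P.L : ℝ) ^ 2 * a + 143 * (((((P.d + 4) * P.L : ℕ) : ℝ) ^ 2 / 4) * a) ^ 2 := by
  have hne : μ ≠ ν := ne_of_lt hμν
  have hL := AveragingRT.two_mul_half_add_one P
  -- (W) the loop variables at the four bonds: each lives in two of the four blocks
  have hW : ∀ (c : PBond P (j + 1)),
      ((c.src = y ∨ c.src = y.shift μ ∨ c.src = y.shift ν ∨ c.src = (y.shift μ).shift ν) ∧
        (c.tgt = y ∨ c.tgt = y.shift μ ∨ c.tgt = y.shift ν ∨ c.tgt = (y.shift μ).shift ν)) →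
      ∀ i, dist1 (loopHol U c i) ≤ ((((P.d + 2) * P.L : ℕ) : ℝ) ^ 2 / 4) * a := by
    rintro c ⟨hsrc, htgt⟩ i
    refine dist1_loopHol_le_twoBlock hj ha c (fun q h1 h2 => hU q ?_ ?_) i
    · rcases h1 with h1 | h1 <;> rw [h1]
      · exact hsrc
      · exact htgt
    · rcases h2 with h2 | h2 <;> rw [h2]
      · exact hsrc
      · exact htgt
  have hW₁ := hW ⟨y, μ⟩ ⟨Or.inl rfl, Or.inr (Or.inl rfl)⟩
  have hW₂ := hW ⟨y.shift μ, ν⟩ ⟨Or.inr (Or.inl rfl), Or.inr (Or.inr (Or.inr rfl))⟩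
  have hW₃ := hW ⟨y.shift ν, μ⟩ ⟨Or.inr (Or.inr (Or.inl rfl)), Or.inr (Or.inr (Or.inr (by
    show (y.shift ν).shift μ = (y.shift μ).shift ν
    exact (shift_shift_comm y μ ν).symm)))⟩
  have hW₄ := hW ⟨y, ν⟩ ⟨Or.inl rfl, Or.inr (Or.inr (Or.inl rfl))⟩
  -- the product-set form of the hypothesis
  have hUpi : ∀ q : Plaq P j,
      q.src ∈ {z : Site P j | ∀ κ, z κ ∈ (fun κ => {t : ZMod (P.sitesPerDir j) |
        (((t.val / P.L : ℕ) : ZMod (P.sitesPerDir (j + 1))) = y κ) ∨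
        (((t.val / P.L : ℕ) : ZMod (P.sitesPerDir (j + 1))) = (y.shift μ) κ) ∨
        (((t.val / P.L : ℕ) : ZMod (P.sitesPerDir (j + 1))) = (y.shift ν) κ) ∨
        (((t.val / P.L : ℕ) : ZMod (P.sitesPerDir (j + 1))) = ((y.shift μ).shift ν) κ)}) κ} →
      (q.src.shift q.μ).shift q.ν ∈ {z : Site P j | ∀ κ, z κ ∈ (fun κ => {t : ZMod (P.sitesPerDir j) |
        (((t.val / P.L : ℕ) : ZMod (P.sitesPerDir (j + 1))) = y κ) ∨
        (((t.val / P.L : ℕ) : ZMod (P.sitesPerDir (j + 1))) = (y.shift μ) κ) ∨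
        (((t.val / P.L : ℕ) : ZMod (P.sitesPerDir (j + 1))) = (y.shift ν) κ) ∨
        (((t.val / P.L : ℕ) : ZMod (P.sitesPerDir (j + 1))) = ((y.shift μ).shift ν) κ)}) κ} →
      dist1 (GaugeField.plaqHol U q) ≤ a :=
    fun q h1 h2 => hU q ((blockOf_mem_four_iff y hne _).2 h1) ((blockOf_mem_four_iff y hne _).2 h2)
  -- (Z) the transport loops: closed words whose prefixes stay in the four-block box
  have hZ : ∀ (r : Fin P.d → Fin P.L) (σ ρ : Equiv.Perm (Fin P.d)),
      dist1 (holAt U (walk (emb y) (stairWord σ (off r) ++ (List.replicate P.L (μ, true) ++ (List.replicate P.L (ν, true) ++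
        (wordRev (stairWord ρ (off r)) ++ (List.replicate P.L (ν, false) ++ List.replicate P.L (μ, false)))))))) ≤
      ((((P.d + 4) * P.L : ℕ) : ℝ) ^ 2 / 4) * a := by
    intro r σ ρ
    have h := dist1_holAt_le_pi' U ha hUpi _ (netDisp_zWord μ ν σ ρ (off r)) (emb y) (fun k =>
      (blockOf_mem_four_iff y hne _).1 (blockOf_mem_four_of_near hj y hne _ _ (fun κ => by rw [walkEnd_apply])
        (fun κ => (netDisp_take_zWord (L := P.L) (h := (P.L - 1) / 2) μ ν (off r) (off_bounds r) σ ρ k κ).1)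
        (fun κ => by
          have h2 := (netDisp_take_zWord (L := P.L) (h := (P.L - 1) / 2) μ ν (off r) (off_bounds r) σ ρ k κ).2
          by_cases h1 : κ = μ
          · subst h1; simp only [true_or, if_true, show ¬ (ν = κ) from fun h => hne h.symm, if_false, add_zero] at h2 ⊢; exact h2
          · by_cases h3 : κ = ν
            · subst h3; simp only [or_true, if_true, show ¬ (μ = κ) from fun h => h1 h.symm, if_false, zero_add] at h2 ⊢; exact h2
            · simp only [h1, h3, or_self, if_false, show ¬ (μ = κ) from fun h => h1 h.symm, show ¬ (ν = κ) from fun h => h3 h.symm,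
                zero_add] at h2 ⊢; exact h2)))
    refine h.trans (mul_le_mul_of_nonneg_right ?_ ha)
    have hlen : ((stairWord σ (off r) ++ (List.replicate P.L (μ, true) ++ (List.replicate P.L (ν, true) ++
        (wordRev (stairWord ρ (off r)) ++ (List.replicate P.L (ν, false) ++ List.replicate P.L (μ, false)))))).length : ℝ) ≤
        (((P.d + 4) * P.L : ℕ) : ℝ) := by exact_mod_cast length_zWord_le μ ν σ ρ r
    have h0 : (0 : ℝ) ≤ ((stairWord σ (off r) ++ (List.replicate P.L (μ, true) ++ (List.replicate P.L (ν, true) ++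
        (wordRev (stairWord ρ (off r)) ++ (List.replicate P.L (ν, false) ++ List.replicate P.L (μ, false)))))).length : ℝ) := Nat.cast_nonneg _
    nlinarith
  -- (Q) the straight and the translated squares
  have hsq : dist1 (rect U (emb y) μ ν P.L P.L) ≤ (P.L : ℝ) ^ 2 * a :=
    dist1_rect_le_fourBlock hj y hμν U hU (emb y) (fun _ => 0) (fun κ => by simp) (fun κ => by constructor <;> omega)
  have hsqσ : ∀ (r : Fin P.d → Fin P.L) (σ : Equiv.Perm (Fin P.d)),
      dist1 (rect U (walkEnd (emb y) (stairWord σ (off r))) μ ν P.L P.L) ≤ (P.L : ℝ) ^ 2 * a := fun r σ =>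
    dist1_rect_le_fourBlock hj y hμν U hU _ (off r) (fun κ => walkEnd_stairWord_apply _ σ (off r) κ) (off_bounds r)
  exact dist1_plaqHol_avgFun_le_of_atoms ha hs y hμν hW₁ hW₂ hW₃ hW₄ hZ hsq hsqσ

end FourBlock

/-! ## §2 Regional corollaries: the one-step form of the regional Prop. 2 -/

section Region

/-- In the four-block product set, the lower-left and upper-right corners of a plaquette control the other two corners (coordinate mixing).
[folklore] -/
theorem blockOf_corners_mem_four (y : Site P (j + 1)) {μ ν : Fin P.d} (hμν : μ ≠ ν) (q : Plaq P j)
    (h1 : blockOf q.src = y ∨ blockOf q.src = y.shift μ ∨ blockOf q.src = y.shift ν ∨ blockOf q.src = (y.shift μ).shift ν)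
    (h2 : blockOf ((q.src.shift q.μ).shift q.ν) = y ∨ blockOf ((q.src.shift q.μ).shift q.ν) = y.shift μ ∨
      blockOf ((q.src.shift q.μ).shift q.ν) = y.shift ν ∨ blockOf ((q.src.shift q.μ).shift q.ν) = (y.shift μ).shift ν) :
    (blockOf (q.src.shift q.μ) = y ∨ blockOf (q.src.shift q.μ) = y.shift μ ∨ blockOf (q.src.shift q.μ) = y.shift ν ∨
      blockOf (q.src.shift q.μ) = (y.shift μ).shift ν) ∧
    (blockOf (q.src.shift q.ν) = y ∨ blockOf (q.src.shift q.ν) = y.shift μ ∨ blockOf (q.src.shift q.ν) = y.shift ν ∨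
      blockOf (q.src.shift q.ν) = (y.shift μ).shift ν) := by
  have hne : ((q.μ, true) : Letter P.d).1 ≠ ((q.ν, true) : Letter P.d).1 := ne_of_lt q.hμν
  have e1 : q.src.shift q.μ = walkEnd q.src [(q.μ, true)] := rfl
  have e2 : q.src.shift q.ν = walkEnd q.src [(q.ν, true)] := rfl
  have e3 : (q.src.shift q.μ).shift q.ν = walkEnd q.src [(q.μ, true), (q.ν, true)] := rfl
  rw [e3] at h2
  obtain ⟨hμ', hν'⟩ := walkEnd_single_mem_pi hne ((blockOf_mem_four_iff y hμν _).1 h1) ((blockOf_mem_four_iff y hμν _).1 h2)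
  rw [e1, e2]
  exact ⟨(blockOf_mem_four_iff y hμν _).2 hμ', (blockOf_mem_four_iff y hμν _).2 hν'⟩

/-- **THE SHARP PROP. 1 AT EVERY COARSE PLAQUETTE WITH CORNERS IN A SET `R` OF COARSE SITES, FROM THE FINE PLAQUETTES OVER `R`**: if every
level-`j` plaquette all of whose four corners lie in blocks of `R` is within `a ≥ 0` of `1` (`(((d+4)L)²/4)·a ≤ δ_N/2`, standing range), then
every level-`(j+1)` plaquette with all four corners in `R` has `|Ū(∂p′) − 1| ≤ L²a + 143·((((d+4)L)²/4)·a)²`.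
[cite: Balaban1985Averaging, Prop. 1 (51) pp.25–26] -/
theorem dist1_plaqHol_avgFun_le_sharp_of_region (hj : j + 1 ≤ P.m + P.K) {a : ℝ} (ha : 0 ≤ a)
    {U : GaugeField P j (Matrix.specialUnitaryGroup n ℂ)} (hs : ((((P.d + 4) * P.L : ℕ) : ℝ) ^ 2 / 4) * a ≤ deltaSU n / 2)
    (R : Set (Site P (j + 1)))
    (hU : ∀ q : Plaq P j, blockOf q.src ∈ R → blockOf (q.src.shift q.μ) ∈ R → blockOf (q.src.shift q.ν) ∈ R →
      blockOf ((q.src.shift q.μ).shift q.ν) ∈ R → dist1 (GaugeField.plaqHol U q) ≤ a)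
    (p : Plaq P (j + 1)) (h1 : p.src ∈ R) (h2 : p.src.shift p.μ ∈ R) (h3 : p.src.shift p.ν ∈ R) (h4 : (p.src.shift p.μ).shift p.ν ∈ R) :
    dist1 (GaugeField.plaqHol (avgFun (expMeanLogSU (n := n)) U) p) ≤
      (P.L : ℝ) ^ 2 * a + 143 * (((((P.d + 4) * P.L : ℕ) : ℝ) ^ 2 / 4) * a) ^ 2 := by
  obtain ⟨y, μ, ν, hμν⟩ := p
  have hmem : ∀ z : Site P j, (blockOf z = y ∨ blockOf z = y.shift μ ∨ blockOf z = y.shift ν ∨ blockOf z = (y.shift μ).shift ν) →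
      blockOf z ∈ R := by
    intro z hz
    rcases hz with h | h | h | h <;> rw [h] <;> assumption
  refine dist1_plaqHol_avgFun_le_fourBlock hj ha hs y hμν fun q hq1 hq2 => ?_
  obtain ⟨hqμ, hqν⟩ := blockOf_corners_mem_four y (ne_of_lt hμν) q hq1 hq2
  exact hU q (hmem _ hq1) (hmem _ hqμ) (hmem _ hqν) (hmem _ hq2)

/-- **`PlaqSmallOn` FORM** (strict): smallness `< a` (`0 < a`) of the fine plaquettes whose four corners lie in blocks of `R` gives
`< L²a + 143·((((d+4)L)²/4)·a)²` at every coarse plaquette with all four corners in `R` (finite lattice: a strictly smaller non-strict level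
bounds the finitely many hypotheses). [cite: Balaban1985Averaging, Prop. 1 (51) pp.25–26] -/
theorem plaqSmallOn_avgFun_sharp_of_region (hj : j + 1 ≤ P.m + P.K) {a : ℝ} (ha : 0 < a)
    {U : GaugeField P j (Matrix.specialUnitaryGroup n ℂ)} (hs : ((((P.d + 4) * P.L : ℕ) : ℝ) ^ 2 / 4) * a ≤ deltaSU n / 2)
    (R : Set (Site P (j + 1)))
    (hU : ∀ q : Plaq P j, blockOf q.src ∈ R → blockOf (q.src.shift q.μ) ∈ R → blockOf (q.src.shift q.ν) ∈ R →
      blockOf ((q.src.shift q.μ).shift q.ν) ∈ R → dist1 (GaugeField.plaqHol U q) < a) :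
    PlaqSmallOn {p : Plaq P (j + 1) | p.src ∈ R ∧ p.src.shift p.μ ∈ R ∧ p.src.shift p.ν ∈ R ∧ (p.src.shift p.μ).shift p.ν ∈ R}
      ((P.L : ℝ) ^ 2 * a + 143 * (((((P.d + 4) * P.L : ℕ) : ℝ) ^ 2 / 4) * a) ^ 2)
      ((blockAvg (expMeanLogSU (n := n))).avg U) := by
  classical
  -- a strictly smaller non-strict level `a′ < a` bounding the finitely many hypotheses
  obtain ⟨a', ha'0, ha'a, hU'⟩ : ∃ a', 0 ≤ a' ∧ a' < a ∧
      ∀ q : Plaq P j, blockOf q.src ∈ R → blockOf (q.src.shift q.μ) ∈ R → blockOf (q.src.shift q.ν) ∈ R →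
        blockOf ((q.src.shift q.μ).shift q.ν) ∈ R → dist1 (GaugeField.plaqHol U q) ≤ a' := by
    let S : Finset (Plaq P j) := Finset.univ.filter fun q => blockOf q.src ∈ R ∧ blockOf (q.src.shift q.μ) ∈ R ∧
      blockOf (q.src.shift q.ν) ∈ R ∧ blockOf ((q.src.shift q.μ).shift q.ν) ∈ R
    by_cases hne : S.Nonempty
    · obtain ⟨q₀, hq₀, hmax⟩ := Finset.exists_mem_eq_sup' hne fun q => dist1 (GaugeField.plaqHol U q)
      have hq₀' : blockOf q₀.src ∈ R ∧ blockOf (q₀.src.shift q₀.μ) ∈ R ∧ blockOf (q₀.src.shift q₀.ν) ∈ R ∧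
          blockOf ((q₀.src.shift q₀.μ).shift q₀.ν) ∈ R := by simpa [S] using hq₀
      refine ⟨S.sup' hne fun q => dist1 (GaugeField.plaqHol U q), ?_, ?_, fun q h1 h2 h3 h4 =>
        Finset.le_sup' (fun q => dist1 (GaugeField.plaqHol U q)) (by simp [S, h1, h2, h3, h4])⟩
      · rw [hmax]; exact GaugeGroup.dist1_nonneg _
      · rw [hmax]; exact hU q₀ hq₀'.1 hq₀'.2.1 hq₀'.2.2.1 hq₀'.2.2.2
    · refine ⟨0, le_rfl, ha, fun q h1 h2 h3 h4 => ?_⟩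
      exact absurd ⟨q, by simp [S, h1, h2, h3, h4]⟩ hne
  intro p hp
  obtain ⟨h1, h2, h3, h4⟩ := hp
  rw [blockAvg_avg]
  have hs' : ((((P.d + 4) * P.L : ℕ) : ℝ) ^ 2 / 4) * a' ≤ deltaSU n / 2 :=
    (mul_le_mul_of_nonneg_left ha'a.le (by positivity)).trans hs
  refine (dist1_plaqHol_avgFun_le_sharp_of_region hj ha'0 hs' R hU' p h1 h2 h3 h4).trans_lt ?_
  have hLpos : (0 : ℝ) < (P.L : ℝ) ^ 2 := by have := P.L_pos; positivity
  have e1 : (P.L : ℝ) ^ 2 * a' < (P.L : ℝ) ^ 2 * a := mul_lt_mul_of_pos_left ha'a hLpos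
  have e2 : (((((P.d + 4) * P.L : ℕ) : ℝ) ^ 2 / 4) * a') ^ 2 ≤ (((((P.d + 4) * P.L : ℕ) : ℝ) ^ 2 / 4) * a) ^ 2 := by
    gcongr
  linarith

end Region

end Summit.QuantumFields.YangMills.Theorems.BoxStokes
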